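import Summits.HodgeConjecture.CorCM.Model.ProdSection
import Summits.HodgeConjecture.CorCM.Model.CupExterior
import Summits.HodgeConjecture.CorCM.Model.CupRingFacts
import Summits.HodgeConjecture.CorCM.Model.PerLConeFacts
import Summits.HodgeConjecture.CorCM.Model.ModelFacts
import Summits.HodgeConjecture.CorCM.Model.ExteriorAlgebraFacts
import Summits.HodgeConjecture.CorCM.Proofs.Pohlmann.FactorActDescent2
import Summits.HodgeConjecture.CorCM.Proofs.Pohlmann.FactorActDescentFields
import HarnessLib

/-!
# COR-CM model layer (model-2; filed by b21): F2 `Fact_factorActDescends` on the Picard–CM model universe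

Cell `pub-hodgecm2` (COR-CM), row Fg2 of `BINDER-OWNERS.md` = stage-1 §1c fact F2 = M35
`Universe.Fact_factorActDescends` (`StubTree/Qw8GeometricBlocks.lean`).

The stage-1 package PROVES F2 from `ModelAxioms` (fields used: M1 `pull_id`, M2 `pull_comp`, M3 `pull_cup`,
M18 `lift`, M21 `kunneth1`), N1 `Fact_cupExterior`, N3 `Fact_pull_H0` and the class-M fact `Fact_prodSection`
(`Proofs/Pohlmann/FactorActDescent.lean`, ported as `CorCM/Proofs/Pohlmann/FactorActDescent{1,2}.lean`:
`Universe.fact_factorActDescends_of_prodSection`; field-level form `Universe.FieldLevel.fact_factorActDescends_of_facts`,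
`CorCM/Proofs/Pohlmann/FactorActDescentFields.lean`).  On the model of record `U₀ := Model.universeOf hHD hI hU h₃`
the three extra inputs are theorems of this cell (`universeOf_fact_cupExterior`, `universeOf_fact_pull_H0`,
`var_prodSection`), and so are the five fields (`universeOf_fact_pull_id`, `universeOf_fact_pull_comp`,
`universeOf_fact_pull_cup` — `Model/PerLConeFacts.lean`; `universeOf_lift` — `Model/ModelFacts.lean`;
`universeOf_fact_kunneth1` — `Model/ExteriorAlgebraFacts.lean`).  Hence:

* `universeOf_fact_factorActDescends (M : U₀.ModelAxioms) : U₀.Fact_factorActDescends` — F2 GIVEN the record, exactly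
  the form in which the E term's chain (`Assembly/CorCMOfPeriodThmF`, `Assembly/ModelChain`) consumes it;
* `universeOf_fact_factorActDescends_of_rows : U₀.Fact_factorActDescends` — F2 UNCONDITIONALLY (no record, no cited
  binder): the row's exact type over the displayed binders `hHD hI hU h₃`.
-/

noncomputable section

open Literature.AlgebraicGeometry.ShimuraVarieties
open Literature.NumberTheory.Automorphic
open Literature.NumberTheory.Automorphic.PicardCM
open Literature.AlgebraicGeometry.HodgeTheory

namespace Summit.HodgeConjecture.CorCM.Model

/-- **`Fact_prodSection` on the model of record**: both projections of every binary product of the Picard–CM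
universe have sections (`var_prodSection`; the universe's `Mor/prod/comp/fst/snd/idMor` are those of
`PicardCM.Var` by definition). [folklore] -/
theorem universeOf_fact_prodSection (hHD : exists_isReal_hodgeModel) (hI : hodgePQ_independent_of_hodgeModel)
    (hU : BallQuotientUniformisedDatum) (h₃ : CMAbelianVarietyRealised) :
    (universeOf hHD hI hU h₃).Fact_prodSection :=
  var_prodSection hU h₃

/-- **F2 = M35 `Fact_factorActDescends` on the model of record, given its `ModelAxioms`** (the package's
derivation `fact_factorActDescends_of_prodSection` fed with the cell's N1, N3 and `Fact_prodSection` theorems for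
`universeOf`). [cite: Pohlmann1968, §1 Thm 1] -/
theorem universeOf_fact_factorActDescends (hHD : exists_isReal_hodgeModel) (hI : hodgePQ_independent_of_hodgeModel)
    (hU : BallQuotientUniformisedDatum) (h₃ : CMAbelianVarietyRealised)
    (M : (universeOf hHD hI hU h₃).ModelAxioms) : (universeOf hHD hI hU h₃).Fact_factorActDescends :=
  Universe.fact_factorActDescends_of_prodSection M (universeOf_fact_cupExterior hHD hI hU h₃)
    (universeOf_fact_pull_H0 hHD hI hU h₃) (universeOf_fact_prodSection hHD hI hU h₃)

/-- **F2 = M35 `Fact_factorActDescends` on the model of record, UNCONDITIONALLY** — the field-level derivation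
`Universe.FieldLevel.fact_factorActDescends_of_facts` fed with the landed junction theorems of rows M05 `pull_id`,
M01 `pull_comp`, M02 `pull_cup` (`Model/PerLConeFacts.lean`), M10 `lift` (`Model/ModelFacts.lean`), M15 `kunneth1`
(`Model/ExteriorAlgebraFacts.lean`), N1 `cupExterior` (`Model/CupExterior.lean`), N3 `pull_H0`
(`Model/CupRingFacts.lean`) and `Fact_prodSection` (`Model/ProdSection.lean`): the exact row type
`(universeOf hHD hI hU h₃).Fact_factorActDescends` over the displayed binders only. [cite: Pohlmann1968, §1 Thm 1] -/
theorem universeOf_fact_factorActDescends_of_rows (hHD : exists_isReal_hodgeModel)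
    (hI : hodgePQ_independent_of_hodgeModel) (hU : BallQuotientUniformisedDatum) (h₃ : CMAbelianVarietyRealised) :
    (universeOf hHD hI hU h₃).Fact_factorActDescends :=
  Universe.FieldLevel.fact_factorActDescends_of_facts (universeOf_fact_pull_id hHD hI hU h₃)
    (universeOf_fact_pull_comp hHD hI hU h₃) (universeOf_fact_pull_cup hHD hI hU h₃) (universeOf_lift hHD hI hU h₃)
    (universeOf_fact_kunneth1 hHD hI hU h₃) (universeOf_fact_cupExterior hHD hI hU h₃)
    (universeOf_fact_pull_H0 hHD hI hU h₃) (universeOf_fact_prodSection hHD hI hU h₃)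

/-- The model of record `Model.picardCMUniverse hHD hI h₁ h₃` (`= universeOf hHD hI (ballQuotientUniformisedDatum_of h₁) h₃`
by `rfl`) satisfies F2 = M35 `Fact_factorActDescends`, unconditionally. [cite: Pohlmann1968, §1 Thm 1] -/
theorem picardCMUniverse_fact_factorActDescends (hHD : exists_isReal_hodgeModel)
    (hI : hodgePQ_independent_of_hodgeModel) (h₁ : BallQuotientUniformised) (h₃ : CMAbelianVarietyRealised) :
    (picardCMUniverse hHD hI h₁ h₃).Fact_factorActDescends :=
  universeOf_fact_factorActDescends_of_rows hHD hI (ballQuotientUniformisedDatum_of h₁) h₃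

end Summit.HodgeConjecture.CorCM.Model
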